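import Summits.QuantumAdvantage.QuantumAdvantage.Theorems.WbwObfuscatedGluedTreesKowPhPrograms
import Literature.Computability.Complexity.TruthTableTransducers

/-!
# `WbwObfuscatedGluedTrees` (stmt-QuantumAdvantage-2340) — line `knowledge-of-walk-split`, STAGE 7: the adaptive
# transducer `adFnAlgL` is a polynomial-time oracle machine computing its straight-line program

Helper file of the PRF hybrid (stage 7) of the line `knowledge-of-walk-split`: the generic device `adFnAlgL FQ FG m`
(KowPhVocabulary §3), the ADAPTIVE sibling of the tree's non-adaptive transducer `ttFnAlgL`
(`Literature/Computability/Complexity/TruthTableTransducers.lean`), is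

* polynomial-time (`OracleAlg.IsPolyTime`) as soon as its two string maps `FQ, FG` are in `FP`: the step-function
  input of `IsPolyTime` is exactly `⟨x, code of the answers⟩`, so the step as a string map is the `P`-guarded
  conditional `condFn (GoOn (C m)) (0 · FQ) (1 · FG)`;
* against EVERY oracle `O`, within any budget of more than `m` rounds, it outputs `runProg Q G m O a` on the code
  `e a` whenever `FQ`/`FG` realise the plain-data maps `Q`/`G` along `e`, and every query it asks is one of the
  program's queries `Q a (progAnswers Q O a j)`, `j < m`.

This is the registered stub `stub_transducer` of the crux skeleton (used with `m = 4` for layer B and `m = 7` for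
layer C). [cite: LadnerLynchSelman1975, §3] (transducers; Arora–Barak 2009, §3.4, oracle machines).
-/

set_option linter.dupNamespace false

noncomputable section

namespace Summit.QuantumAdvantage.QuantumAdvantage.Theorems.WbwObfuscatedGluedTrees.KnowledgeOfWalk.PrfHybrid

open Literature.Computability.Complexity Literature.Computability.QuantumComplexity
open Literature.Computability.QuantumComplexity.GluedTrees
open Literature.Computability.Cryptography Literature.Computability.Cryptography.ObfuscatedGluedTrees
open Summit.QuantumAdvantage.QuantumAdvantage.Theorems.WbwObfuscatedGluedTrees.KnowledgeOfWalk.BlackBox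
open Summit.QuantumAdvantage.QuantumAdvantage.Theorems.WbwObfuscatedGluedTrees.KnowledgeOfWalk.RealIdeal
open _root_.Computability
open Literature.Computability.Complexity.PRelSigma Literature.Computability.Complexity.OracleCompose
open Literature.Computability.Complexity.TTClosure

/-! ## The step function of `adFnAlgL` as a string map -/

section Step

/-- **The step function of `adFnAlgL` as a string map is in `FP`**: guarded by "fewer than `m` answers"
(`GoOn (C m)`), the query code `0 · FQ w`, else the output code `1 · FG w` — both maps applied to the step input
`w = ⟨x, code of the answers⟩` itself; in `FP` for `FQ, FG ∈ FP`. [folklore] -/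
theorem adStepSL_mem_FP {FQ FG : List Bool → List Bool} (m : ℕ) (hFQ : FQ ∈ FP) (hFG : FG ∈ FP) :
    condFn (GoOn (Polynomial.C m)) (List.cons false ∘ FQ) (List.cons true ∘ FG) ∈ FP :=
  condFn_mem_FP (GoOn_mem_P _) (comp_mem_FP (cons_mem_FP false) hFQ) (comp_mem_FP (cons_mem_FP true) hFG)

/-- **The string map computes the step function** of `adFnAlgL` (on the coded step input). [folklore] -/
theorem adStepSL_apply (FQ FG : List Bool → List Bool) (m : ℕ) (x : List Bool) (ans : List (List Bool)) :
    condFn (GoOn (Polynomial.C m)) (List.cons false ∘ FQ) (List.cons true ∘ FG)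
        (boolPair x ((encodingList Bool).listBool.encode ans)) =
      stepCodeL ((adFnAlgL FQ FG m).step x ans) := by
  by_cases h : ans.length < m
  · rw [condFn_of_mem _ _ ((mem_GoOn_iff x ans).2 (by rwa [Polynomial.eval_C])),
      adFnAlgL_step_of_lt FQ FG m x h, stepCodeL_inl, Function.comp_apply]
  · rw [condFn_of_not_mem _ _ (fun h' => h (by simpa using (mem_GoOn_iff x ans).1 h')),
      adFnAlgL_step_of_le FQ FG m x (Nat.not_lt.1 h), stepCodeL_inr, Function.comp_apply]

/-- **`adFnAlgL` is polynomial-time** for `FQ, FG ∈ FP`. [cite: LadnerLynchSelman1975, §3] -/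
theorem isPolyTime_adFnAlgL {FQ FG : List Bool → List Bool} (m : ℕ) (hFQ : FQ ∈ FP) (hFG : FG ∈ FP) :
    (adFnAlgL FQ FG m).IsPolyTime (encodingList Bool) := by
  obtain ⟨p, Mx, h⟩ := adStepSL_mem_FP m hFQ hFG
  refine ⟨p, Mx, fun z => ?_⟩
  have hz := h (boolPair z.1 ((encodingList Bool).listBool.encode z.2))
  rw [id, adStepSL_apply] at hz
  exact hz

end Step

/-! ## The run and the queries of `adFnAlgL` against an arbitrary oracle -/

section Run

variable {α : Type} {e : α → List Bool} {Q G : α → List (List Bool) → List Bool} {FQ FG : List Bool → List Bool}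
  {m : ℕ}

/-- One more program step. [folklore] -/
theorem progAnswers_succ (Q : α → List (List Bool) → List Bool) (O : Oracle) (a : α) (j : ℕ) :
    progAnswers Q O a (j + 1) = progAnswers Q O a j ++ [O (Q a (progAnswers Q O a j))] :=
  rfl

/-- **The transcript of `adFnAlgL` against an arbitrary oracle** is the program's answer list, as long as `FQ`
realises `Q`. [folklore] -/
theorem trans_adFnAlgL (hQ : Realises e FQ Q) (FG : List Bool → List Bool) (O : Oracle) (a : α) :
    ∀ i ≤ m, trans (adFnAlgL FQ FG m) O (e a) i = progAnswers Q O a i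
  | 0, _ => by simp [progAnswers]
  | i + 1, hi => by
    have ih := trans_adFnAlgL hQ FG O a i (Nat.le_of_succ_le hi)
    rw [trans_succ, ih, qryOf_eq_of_step_eq (adFnAlgL_step_of_lt FQ FG m (e a) (by simp; omega)), hQ,
      progAnswers_succ]

/-- **`adFnAlgL` computes `runProg`** within any budget of more than `m` rounds, against every oracle, as soon as
`FQ`/`FG` realise `Q`/`G`. [cite: LadnerLynchSelman1975, §3] -/
theorem run_adFnAlgL (hQ : Realises e FQ Q) (hG : Realises e FG G) (O : Oracle) (a : α) {k : ℕ} (hk : m < k) :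
    (adFnAlgL FQ FG m).run O k (e a) = some (runProg Q G m O a) := by
  rw [run_eq_some_iff]
  refine ⟨m, hk, fun i hi => ⟨FQ (boolPair (e a) ((encodingList Bool).listBool.encode (progAnswers Q O a i))), ?_⟩,
    ?_⟩
  · rw [trans_adFnAlgL hQ FG O a i hi.le, adFnAlgL_step_of_lt FQ FG m (e a) (by simpa using hi)]
  · rw [trans_adFnAlgL hQ FG O a m le_rfl, adFnAlgL_step_of_le FQ FG m (e a) (by simp), hG]
    rfl

/-- **The queries of `adFnAlgL` are the program's**: every recorded query is `Q a (progAnswers Q O a j)` for some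
`j < m`, whatever the oracle and the budget. [folklore] -/
theorem exists_of_mem_queries_adFnAlgL (hQ : Realises e FQ Q) (FG : List Bool → List Bool) (O : Oracle) (a : α)
    {k : ℕ} {y : List Bool} (hy : y ∈ (adFnAlgL FQ FG m).queries O k (e a)) :
    ∃ j < m, y = Q a (progAnswers Q O a j) := by
  obtain ⟨i, -, hall, rfl⟩ := exists_of_mem_queries _ _ k (e a) y hy
  have hi : i < m := by
    by_contra hle
    obtain ⟨y', hy'⟩ := hall m (Nat.not_lt.1 hle)
    rw [trans_adFnAlgL hQ FG O a m le_rfl, adFnAlgL_step_of_le FQ FG m (e a) (by simp)] at hy'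
    cases hy'
  refine ⟨i, hi, ?_⟩
  rw [trans_adFnAlgL hQ FG O a i hi.le,
    qryOf_eq_of_step_eq (adFnAlgL_step_of_lt FQ FG m (e a) (by simpa using hi)), hQ]

end Run

/-! ## The registered stub -/

/-- **Stub (generic): the adaptive transducer** is polynomial-time for `FP` step maps, and against EVERY oracle it
computes the adaptive straight-line program its maps realise, asking only the program's queries.
[cite: LadnerLynchSelman1975, §3] -/
theorem stub_transducer :
    (∀ (FQ FG : List Bool → List Bool) (m : ℕ), FQ ∈ FP → FG ∈ FP →
        (adFnAlgL FQ FG m).IsPolyTime (encodingList Bool)) ∧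
      ∀ {α : Type} (e : α → List Bool) (Q G : α → List (List Bool) → List Bool) (FQ FG : List Bool → List Bool)
        (m : ℕ), Realises e FQ Q → Realises e FG G →
        ∀ (O : Oracle) (a : α) (k : ℕ), m < k →
          (adFnAlgL FQ FG m).run O k (e a) = some (runProg Q G m O a) ∧
            ∀ y ∈ (adFnAlgL FQ FG m).queries O k (e a), ∃ j < m, y = Q a (progAnswers Q O a j) :=
  ⟨fun _ _ m hFQ hFG => isPolyTime_adFnAlgL m hFQ hFG,
    fun _ _ _ _ FG _ hQ hG O a _ hk =>
      ⟨run_adFnAlgL hQ hG O a hk, fun _ hy => exists_of_mem_queries_adFnAlgL hQ FG O a hy⟩⟩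

end Summit.QuantumAdvantage.QuantumAdvantage.Theorems.WbwObfuscatedGluedTrees.KnowledgeOfWalk.PrfHybrid

end
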